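import Literature.MathematicalPhysics.QuantumFieldTheory.Balaban1983to89.B11Eq103H1Complex

/-!
# `Balaban1983to89.B9Eq386GreenLipschitzEnergy` — T. Bałaban, *Propagators for lattice gauge theories in a background field*, Commun. Math. Phys. **99**
# (1985) 389–434 [Balaban1985BackgroundPropagators] (3.84)–(3.86) p. 407 with Thm 3.4 p. 400 and Thm 3.11 p. 416: **THE PERTURBATION OF THE GREEN's
# FUNCTION IN THE BACKGROUND, IN THE ENERGY NORM — `N(G₀y − G₁y) ≤ (Θ∕γ)·N(G₀y)` FROM A STRONG COERCIVITY `γN(z)² ≤ re⟨z, T₁z⟩` AND A FORM DEFECT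
# `|⟨u, (T₁ − T₀)v⟩| ≤ Θ·N(u)N(v)` ALONE — NO OPERATOR BOUND OF `T₁ − T₀`, NO SYMMETRY, NO NEUMANN SERIES** (abstract finite-dimensional `𝕜`-Hilbert letters
# for the pub-balaban NE9 chain's `B11Eq103H1Complex.greenK` ∕ `laplaceAK`)

statement-level skeleton of published theorems with citation tags; proofs where landed; nothing here is a claim about the Yang–Mills mass gap

CITATION HEADER (lean-in-tree rule).  Audit cell `pub-balaban`, sub-cell `t4`, BINDER row NE9; filed by the row OWNER lineage `b2b-balaban-t4-ne9-p1`
(gen 86).  Sources READ first-hand by this lineage in the held text layer [Balaban1985BackgroundPropagators] (`paper:balaban1985-cmp99-background-propagators`,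
journal page = PDF page + 388) pp. 399–400 (Thms 3.3∕3.4, (3.50)–(3.53)), 407 ((3.82)–(3.86)), 416 (Thm 3.11).

THE PRINT (verbatim, text layer).  p. 400, Thm 3.4: *«There exists a positive constant α₁ such that the operators G′(U), (Q′(U)G′²(U)Q′*(U))⁻¹, R(U), G(U)
extend to configurations U′U for α ≤ α₁ as analytic functions of A. The extended operators satisfy all the inequalities of Theorems 3.1–3.3 correspondingly.
In fact we prove quantitative statements which are more precise, describing these analytic extensions as small perturbations of the operators depending on U
only.»*; p. 407, (3.86): *«G(U′U) = G(U)(I − V(A)G(U))⁻¹ … convergence is in the operator norm for α₁ sufficiently small»*; p. 400, (3.53): *«Δ_{U′U} = Δ_U − V₁(A)»*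
with (3.52) `V₁(A)` a FIRST-ORDER operator in the derivatives.

WHY THIS FILE (cell context; the owner's programme «THE 𝔊-STOREY IN THE ENERGY CURRENCY», D-ne9p1-g86-1).  The chain's perturbation letters for the Green's
functions (`B9Eq386ResolventLetters.norm_greenK_sub_greenK_le`, owner g81: `‖G₁ − G₂‖ ≤ δ∕(γ₁γ₂)` from an OPERATOR bound `‖(T₁ − T₂)x‖ ≤ δ‖x‖`) are
level-dependent on the fine lattice: `T₁ − T₂` is a second-order difference operator, `δ ∝ |η|⁻²·(bond window)` (D-ne9p1-g85-1).  Print's `V₁(A)` is FIRST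
order ((3.52)); in the FORM sense the defect of `Δ_a(U) − Δ_a(1)` is `Θ·N₁(u)N₁(v)` with `N₁` the flat energy norm (`‖D₁u‖² + ‖D*₁u‖² + ‖u‖²`) and `Θ ∝ α`
built from FIRST-order letters only (`B9Eq373DerivativeRemainderL2`, the `R`- and `Q`-letters, the curvature operator bound) — level-free on print's diagonal.
This file is the abstract mechanism turning such a form defect into a bound of `G₀y − G₁y` IN THE ENERGY NORM: with `z = G₀y − G₁y` one has EXACTLY
`T₁z = (T₁ − T₀)(G₀y)`, so `γN(z)² ≤ re⟨z, T₁z⟩ ≤ ΘN(z)N(G₀y)` and `N(z) ≤ (Θ∕γ)N(G₀y)` — no symmetry, no Neumann series, no operator bound; the rows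
`N(G₀y) ≤ C₀‖y‖` of the comparison Green's function are the owner's `B9Eq3153FrakGkBoundDiagonal` §2 (this generation).  §1∕§3 are the two tools with which
an instance assembles `Θ`: the bracket `⟨A₁u, A₁v⟩ − ⟨A₀u, A₀v⟩` and the sesquilinear three-products identity of `Δ_a = Δ + DRD* + aQ†Q`.

WHAT IS PROVED (sorry-free; 0 `def`; [folklore] finite-dimensional Hilbert-space algebra; nothing of [B9] asserted as printed).
* §1 **`norm_inner_sub_inner_le`** — for maps `A₁, A₀ : E → V` and a weight `N ≥ 0` with `‖A₁w − A₀w‖ ≤ δN(w)`, `‖A₀w‖ ≤ MN(w)`: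
  `‖⟨A₁u, A₁v⟩ − ⟨A₀u, A₀v⟩‖ ≤ δ(2M + δ)·N(u)N(v)`.
* §2 (any `T₀, T₁ : E →ₗ E` with positive definite real parts, `G_i := greenK T_i`) **`weight_green_le`** (`N(G₀y) ≤ γ₀⁻¹‖y‖` from `γ₀N(z)² ≤ re⟨z, T₀z⟩`,
  `‖z‖ ≤ N(z)`), **`apply_green_sub_eq`** (`T₁(G₀y − G₁y) = T₁(G₀y) − T₀(G₀y)`),
  **`weight_green_sub_le`** (`N(G₀y − G₁y) ≤ (Θ∕γ)·N(G₀y)` from `γN(z)² ≤ re⟨z, T₁z⟩` and `‖⟨u, T₁v⟩ − ⟨u, T₀v⟩‖ ≤ ΘN(u)N(v)`),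
  **`weight_green_sub_le_of_bound`** (`≤ (Θ∕γ)C₀‖y‖` given `N(G₀y) ≤ C₀‖y‖`), **`norm_green_sub_le_of_bound`** (`‖G₀y − G₁y‖ ≤ (Θ∕γ)C₀‖y‖` when `‖z‖ ≤ N(z)`).
* §3 (`Δ_a = laplaceAK Δ D R D* Q Q† a`; `⟪Ds, x⟫ = ⟪s, D*x⟫`, `R` symmetric idempotent) **`inner_laplaceAK_eq`** — `⟨u, Δ_a v⟩ = ⟨u, Δv⟩ + ⟨R(D*u), R(D*v)⟩ + a⟨Qu, Qv⟩`;
  **`norm_inner_laplaceAK_sub_le`** — for two such structures with the same `a`, a form defect `θ_Δ` of the `Δ`-slots and §1-letters `(δ_P, M_P)` for `RD*`,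
  `(δ_Q, M_Q)` for `Q`: `‖⟨u, Δ_a¹v⟩ − ⟨u, Δ_a⁰v⟩‖ ≤ (θ_Δ + δ_P(2M_P + δ_P) + ‖a‖δ_Q(2M_Q + δ_Q))·N(u)N(v)`.
MODEL ∕ HONEST SCOPE.  (M1) `E` finite-dimensional `𝕜`-Hilbert, `V`, `F`, `S` inner-product spaces.  (M2) displayed: the positivity of `T₀, T₁`, the strong coercivity `γ`
of `T₁` in the weight `N`, the form defect `Θ`, the comparison rows `C₀`.  (M3) first order in the background ONLY (the flat point vs `U`); no analyticity, no
Neumann series (3.86), no kernel bound, no decay; crude constants.  NOT summit progress (cell pub-balaban: NE9 NOT PRINTED ∕ NOT PROVED; «NE9 ⇐ the named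
binders»; row WALLED ON A MODEL (O-NE9-1; #5 UNRULED); spine PROVED 0∕9; rung (B)+1 finite T⁴ — NOT infinite volume, NOT mass gap, NOT BetaPertH, NOT Clay).
HONEST DEPENDENCY (cell line): continuum YM on T⁴ ⇐ BetaPertH ∧ nine spine estimates (0/9 proved); BetaPertH ⇐ (D1) ∧ (D4) ∧ CAP+tail; G-an2-4 gates asym, D1
and NE2/3/4.  NEW file importing `B11Eq103H1Complex` only; nothing modified.  Net new unproved facts: 0.
-/

noncomputable section

open scoped InnerProductSpace ComplexConjugate BigOperators

namespace Literature.MathematicalPhysics.QuantumFieldTheory.Balaban1983to89.B9Eq386GreenLipschitzEnergy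

open B11Eq103H1Complex (laplaceAK laplaceAK_apply greenK apply_greenK greenK_apply)

section Abstract

variable {𝕜 : Type*} [RCLike 𝕜] {V : Type*} [NormedAddCommGroup V] [InnerProductSpace 𝕜 V]

/-! ## §1 The bracket `⟨A₁u, A₁v⟩ − ⟨A₀u, A₀v⟩` -/

/-- **THE BRACKET**: `‖⟨A₁u, A₁v⟩ − ⟨A₀u, A₀v⟩‖ ≤ δ(2M + δ)·N(u)N(v)` when `‖A₁w − A₀w‖ ≤ δN(w)` and `‖A₀w‖ ≤ MN(w)` for a weight `N ≥ 0` —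
`⟨A₁u, A₁v⟩ − ⟨A₀u, A₀v⟩ = ⟨A₁u − A₀u, A₁v⟩ + ⟨A₀u, A₁v − A₀v⟩` and `‖A₁v‖ ≤ (M + δ)N(v)`. [folklore] [cite: Balaban1985BackgroundPropagators, (3.52)–(3.53) p.400] -/
theorem norm_inner_sub_inner_le {X : Type*} (A₁ A₀ : X → V) (N : X → ℝ) (hN : ∀ w, 0 ≤ N w) {δ M : ℝ} (hδ : 0 ≤ δ) (hM : 0 ≤ M)
    (hA : ∀ w, ‖A₁ w - A₀ w‖ ≤ δ * N w) (hA₀ : ∀ w, ‖A₀ w‖ ≤ M * N w) (u v : X) :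
    ‖⟪A₁ u, A₁ v⟫_𝕜 - ⟪A₀ u, A₀ v⟫_𝕜‖ ≤ δ * (2 * M + δ) * N u * N v := by
  have hsplit : ⟪A₁ u, A₁ v⟫_𝕜 - ⟪A₀ u, A₀ v⟫_𝕜 = ⟪A₁ u - A₀ u, A₁ v⟫_𝕜 + ⟪A₀ u, A₁ v - A₀ v⟫_𝕜 := by
    rw [inner_sub_left, inner_sub_right]; ring
  have hA₁v : ‖A₁ v‖ ≤ (M + δ) * N v := by
    calc ‖A₁ v‖ = ‖A₀ v + (A₁ v - A₀ v)‖ := by rw [add_sub_cancel]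
      _ ≤ ‖A₀ v‖ + ‖A₁ v - A₀ v‖ := norm_add_le _ _
      _ ≤ M * N v + δ * N v := add_le_add (hA₀ v) (hA v)
      _ = (M + δ) * N v := by ring
  rw [hsplit]
  calc ‖⟪A₁ u - A₀ u, A₁ v⟫_𝕜 + ⟪A₀ u, A₁ v - A₀ v⟫_𝕜‖
      ≤ ‖⟪A₁ u - A₀ u, A₁ v⟫_𝕜‖ + ‖⟪A₀ u, A₁ v - A₀ v⟫_𝕜‖ := norm_add_le _ _
    _ ≤ ‖A₁ u - A₀ u‖ * ‖A₁ v‖ + ‖A₀ u‖ * ‖A₁ v - A₀ v‖ := add_le_add (norm_inner_le_norm _ _) (norm_inner_le_norm _ _)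
    _ ≤ δ * N u * ((M + δ) * N v) + M * N u * (δ * N v) := by
        gcongr
        · exact mul_nonneg hδ (hN u)
        · exact hA u
        · exact mul_nonneg hM (hN u)
        · exact hA₀ u
        · exact hA v
    _ = δ * (2 * M + δ) * N u * N v := by ring

/-! ## §2 The Green's functions' difference in the weight `N` -/

variable {E : Type*} [NormedAddCommGroup E] [InnerProductSpace 𝕜 E] [FiniteDimensional 𝕜 E] {T₀ T₁ : E →ₗ[𝕜] E}
  (hpos₀ : ∀ x : E, x ≠ 0 → 0 < RCLike.re ⟪x, T₀ x⟫_𝕜) (hpos₁ : ∀ x : E, x ≠ 0 → 0 < RCLike.re ⟪x, T₁ x⟫_𝕜)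

/-- **`T₁(G₀y − G₁y) = T₁(G₀y) − T₀(G₀y)`** (`T_iG_i = 1`) — the second resolvent identity needs no inverse on the left. [folklore]
[cite: Balaban1985BackgroundPropagators, (3.84)–(3.86) p.407] -/
theorem apply_green_sub_eq (y : E) :
    T₁ (greenK T₀ hpos₀ y - greenK T₁ hpos₁ y) = T₁ (greenK T₀ hpos₀ y) - T₀ (greenK T₀ hpos₀ y) := by
  rw [map_sub, apply_greenK, apply_greenK]

/-- **`N(G₀y) ≤ γ₀⁻¹‖y‖`** — the rows of a Green's function from a STRONG coercivity `γ₀N(z)² ≤ re⟨z, T₀z⟩` in a weight dominating the norm: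
`γ₀N(G₀y)² ≤ re⟨G₀y, y⟩ ≤ ‖G₀y‖‖y‖ ≤ N(G₀y)‖y‖`. [folklore] [cite: Balaban1985BackgroundPropagators, Thm 3.4 p.400, Thm 3.11 p.416] -/
theorem weight_green_le (N : E → ℝ) (hN : ∀ w, 0 ≤ N w) (hNn : ∀ z : E, ‖z‖ ≤ N z) {γ₀ : ℝ} (hγ₀ : 0 < γ₀)
    (hcoerN₀ : ∀ z : E, γ₀ * N z ^ 2 ≤ RCLike.re ⟪z, T₀ z⟫_𝕜) (y : E) : N (greenK T₀ hpos₀ y) ≤ γ₀⁻¹ * ‖y‖ := by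
  set g := greenK T₀ hpos₀ y with hg
  have h1 : γ₀ * N g ^ 2 ≤ N g * ‖y‖ := by
    calc γ₀ * N g ^ 2 ≤ RCLike.re ⟪g, T₀ g⟫_𝕜 := hcoerN₀ g
      _ = RCLike.re ⟪g, y⟫_𝕜 := by rw [hg, apply_greenK]
      _ ≤ ‖g‖ * ‖y‖ := re_inner_le_norm _ _
      _ ≤ N g * ‖y‖ := mul_le_mul_of_nonneg_right (hNn g) (norm_nonneg _)
  by_cases hNg : N g = 0
  · rw [hNg]; positivity
  · have hNg' : 0 < N g := lt_of_le_of_ne (hN g) (Ne.symm hNg)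
    have h2 : γ₀ * N g ≤ ‖y‖ := by
      have h3 : (γ₀ * N g) * N g ≤ ‖y‖ * N g := by
        calc (γ₀ * N g) * N g = γ₀ * N g ^ 2 := by ring
          _ ≤ N g * ‖y‖ := h1
          _ = ‖y‖ * N g := by ring
      exact le_of_mul_le_mul_right h3 hNg'
    calc N g = γ₀⁻¹ * (γ₀ * N g) := by field_simp
      _ ≤ γ₀⁻¹ * ‖y‖ := mul_le_mul_of_nonneg_left h2 (inv_nonneg.2 hγ₀.le)

variable (N : E → ℝ) (hN : ∀ w, 0 ≤ N w) {γ Θ : ℝ} (hγ : 0 < γ) (hΘ : 0 ≤ Θ)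
  (hcoerN : ∀ z : E, γ * N z ^ 2 ≤ RCLike.re ⟪z, T₁ z⟫_𝕜)
  (hT : ∀ u v : E, ‖⟪u, T₁ v⟫_𝕜 - ⟪u, T₀ v⟫_𝕜‖ ≤ Θ * N u * N v)

include hN hγ hΘ hcoerN hT in
/-- **`N(G₀y − G₁y) ≤ (Θ∕γ)·N(G₀y)`** — THE PERTURBATION OF THE GREEN's FUNCTION IN THE ENERGY WEIGHT: with `z = G₀y − G₁y`,
`γN(z)² ≤ re⟨z, T₁z⟩ = re(⟨z, T₁(G₀y)⟩ − ⟨z, T₀(G₀y)⟩) ≤ ΘN(z)N(G₀y)`.  No symmetry of `T_i`, no operator bound of `T₁ − T₀`. [folklore]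
[cite: Balaban1985BackgroundPropagators, Thm 3.4 p.400, (3.84)–(3.86) p.407, Thm 3.11 p.416] -/
theorem weight_green_sub_le (y : E) : N (greenK T₀ hpos₀ y - greenK T₁ hpos₁ y) ≤ Θ / γ * N (greenK T₀ hpos₀ y) := by
  set z := greenK T₀ hpos₀ y - greenK T₁ hpos₁ y with hz
  have h1 : γ * N z ^ 2 ≤ Θ * N z * N (greenK T₀ hpos₀ y) := by
    calc γ * N z ^ 2 ≤ RCLike.re ⟪z, T₁ z⟫_𝕜 := hcoerN z
      _ = RCLike.re (⟪z, T₁ (greenK T₀ hpos₀ y)⟫_𝕜 - ⟪z, T₀ (greenK T₀ hpos₀ y)⟫_𝕜) := by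
          rw [hz, apply_green_sub_eq hpos₀ hpos₁, inner_sub_right]
      _ ≤ ‖⟪z, T₁ (greenK T₀ hpos₀ y)⟫_𝕜 - ⟪z, T₀ (greenK T₀ hpos₀ y)⟫_𝕜‖ := RCLike.re_le_norm _
      _ ≤ Θ * N z * N (greenK T₀ hpos₀ y) := hT z _
  by_cases hNz : N z = 0
  · rw [hNz]; exact mul_nonneg (div_nonneg hΘ hγ.le) (hN _)
  · have hNz' : 0 < N z := lt_of_le_of_ne (hN z) (Ne.symm hNz)
    have h2 : γ * N z ≤ Θ * N (greenK T₀ hpos₀ y) := by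
      have h3 : (γ * N z) * N z ≤ (Θ * N (greenK T₀ hpos₀ y)) * N z := by
        calc (γ * N z) * N z = γ * N z ^ 2 := by ring
          _ ≤ Θ * N z * N (greenK T₀ hpos₀ y) := h1
          _ = (Θ * N (greenK T₀ hpos₀ y)) * N z := by ring
      exact le_of_mul_le_mul_right h3 hNz'
    calc N z = γ⁻¹ * (γ * N z) := by field_simp
      _ ≤ γ⁻¹ * (Θ * N (greenK T₀ hpos₀ y)) := mul_le_mul_of_nonneg_left h2 (inv_nonneg.2 hγ.le)
      _ = Θ / γ * N (greenK T₀ hpos₀ y) := by rw [div_eq_mul_inv]; ring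

include hN hγ hΘ hcoerN hT in
/-- **`N(G₀y − G₁y) ≤ (Θ∕γ)·C₀·‖y‖`** given the rows `N(G₀y) ≤ C₀‖y‖` of the comparison Green's function (in the chain: the FLAT one,
`B9Eq3153FrakGkBoundDiagonal` §2). [folklore] [cite: Balaban1985BackgroundPropagators, Thm 3.4 p.400, (3.86) p.407] -/
theorem weight_green_sub_le_of_bound {C₀ : ℝ} (hG₀ : ∀ y : E, N (greenK T₀ hpos₀ y) ≤ C₀ * ‖y‖) (y : E) :
    N (greenK T₀ hpos₀ y - greenK T₁ hpos₁ y) ≤ Θ / γ * C₀ * ‖y‖ :=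
  (weight_green_sub_le hpos₀ hpos₁ N hN hγ hΘ hcoerN hT y).trans
    (by rw [mul_assoc]; exact mul_le_mul_of_nonneg_left (hG₀ y) (div_nonneg hΘ hγ.le))

include hN hγ hΘ hcoerN hT in
/-- **`‖G₀y − G₁y‖ ≤ (Θ∕γ)·C₀·‖y‖`** when the weight dominates the norm (`‖z‖ ≤ N(z)`) — the `L²` Lipschitz letter of the Green's function in the background,
FIRST order, from form data only. [folklore] [cite: Balaban1985BackgroundPropagators, Thm 3.4 p.400, (3.86) p.407] -/
theorem norm_green_sub_le_of_bound (hNn : ∀ z : E, ‖z‖ ≤ N z) {C₀ : ℝ} (hG₀ : ∀ y : E, N (greenK T₀ hpos₀ y) ≤ C₀ * ‖y‖) (y : E) :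
    ‖greenK T₀ hpos₀ y - greenK T₁ hpos₁ y‖ ≤ Θ / γ * C₀ * ‖y‖ :=
  (hNn _).trans (weight_green_sub_le_of_bound hpos₀ hpos₁ N hN hγ hΘ hcoerN hT hG₀ y)

end Abstract

/-! ## §3 The sesquilinear three-products identity of `Δ_a = Δ + DRD* + aQ†Q` and the form defect of two such structures -/

section Structure

variable {𝕜 : Type*} [RCLike 𝕜] {E : Type*} [NormedAddCommGroup E] [InnerProductSpace 𝕜 E] [FiniteDimensional 𝕜 E]
  {F : Type*} [NormedAddCommGroup F] [InnerProductSpace 𝕜 F] [FiniteDimensional 𝕜 F] {S : Type*} [NormedAddCommGroup S] [InnerProductSpace 𝕜 S]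

/-- **`⟨u, Δ_a v⟩ = ⟨u, Δv⟩ + ⟨R(D*u), R(D*v)⟩ + a⟨Qu, Qv⟩`** for `Δ_a = Δ + DRD* + aQ†Q` with `⟪Ds, x⟫ = ⟪s, D*x⟫` and `R` symmetric idempotent — the
sesquilinear form of [B11] p. 293's «scalar product defined by the operator Δ₁ + D*RD + aQ*Q» (the owner's `B9Eq3153FrakGVariational.re_inner_laplaceAK_eq` is
the diagonal `u = v`). [folklore] [cite: Balaban1985Variational, (110) p.294, p.293; Balaban1985BackgroundPropagators, (3.26) p.395] -/
theorem inner_laplaceAK_eq {Δ : E →ₗ[𝕜] E} {D : S →ₗ[𝕜] E} {R : S →ₗ[𝕜] S} {Dstar : E →ₗ[𝕜] S} {Q : E →ₗ[𝕜] F} {a : 𝕜}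
    (hadj : ∀ (x : E) (y : F), ⟪Q x, y⟫_𝕜 = ⟪x, LinearMap.adjoint Q y⟫_𝕜) (hDD : ∀ (s : S) (x : E), ⟪D s, x⟫_𝕜 = ⟪s, Dstar x⟫_𝕜)
    (hRsym : ∀ s t : S, ⟪R s, t⟫_𝕜 = ⟪s, R t⟫_𝕜) (hRR : ∀ s : S, R (R s) = R s) (u v : E) :
    ⟪u, laplaceAK Δ D R Dstar Q (LinearMap.adjoint Q) a v⟫_𝕜 = ⟪u, Δ v⟫_𝕜 + ⟪R (Dstar u), R (Dstar v)⟫_𝕜 + a * ⟪Q u, Q v⟫_𝕜 := by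
  have h1 : ⟪u, D (R (Dstar v))⟫_𝕜 = ⟪R (Dstar u), R (Dstar v)⟫_𝕜 := by
    rw [← inner_conj_symm, hDD, inner_conj_symm, ← hRR (Dstar v), ← hRsym, hRR]
  have h2 : ⟪u, LinearMap.adjoint Q (a • Q v)⟫_𝕜 = a * ⟪Q u, Q v⟫_𝕜 := by
    rw [← hadj, inner_smul_right]
  rw [laplaceAK_apply, inner_add_right, inner_add_right, h1, h2]

/-- **THE FORM DEFECT OF TWO `Δ_a`-STRUCTURES** `Δ_aⁱ = Δᵢ + DᵢRᵢDᵢ* + aQᵢ†Qᵢ` (`i = 0, 1`, same `a`, same spaces): from a form defect `θ_Δ` of the `Δ`-slots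
and the §1-letters `‖R₁(D₁*w) − R₀(D₀*w)‖ ≤ δ_PN(w)`, `‖R₀(D₀*w)‖ ≤ M_PN(w)`, `‖Q₁w − Q₀w‖ ≤ δ_QN(w)`, `‖Q₀w‖ ≤ M_QN(w)`:
`‖⟨u, Δ_a¹v⟩ − ⟨u, Δ_a⁰v⟩‖ ≤ (θ_Δ + δ_P(2M_P + δ_P) + ‖a‖δ_Q(2M_Q + δ_Q))·N(u)N(v)` — FIRST-order letters only (print's `V₁(A)` of (3.52)–(3.53)). [folklore]
[cite: Balaban1985BackgroundPropagators, (3.52)–(3.53) p.400, (3.82)–(3.84) p.407, (3.26) p.395] -/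
theorem norm_inner_laplaceAK_sub_le
    {Δ₀ Δ₁ : E →ₗ[𝕜] E} {D₀ D₁ : S →ₗ[𝕜] E} {R₀ R₁ : S →ₗ[𝕜] S} {Dstar₀ Dstar₁ : E →ₗ[𝕜] S} {Q₀ Q₁ : E →ₗ[𝕜] F} {a : 𝕜}
    (hadj₀ : ∀ (x : E) (y : F), ⟪Q₀ x, y⟫_𝕜 = ⟪x, LinearMap.adjoint Q₀ y⟫_𝕜) (hDD₀ : ∀ (s : S) (x : E), ⟪D₀ s, x⟫_𝕜 = ⟪s, Dstar₀ x⟫_𝕜)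
    (hRsym₀ : ∀ s t : S, ⟪R₀ s, t⟫_𝕜 = ⟪s, R₀ t⟫_𝕜) (hRR₀ : ∀ s : S, R₀ (R₀ s) = R₀ s)
    (hadj₁ : ∀ (x : E) (y : F), ⟪Q₁ x, y⟫_𝕜 = ⟪x, LinearMap.adjoint Q₁ y⟫_𝕜) (hDD₁ : ∀ (s : S) (x : E), ⟪D₁ s, x⟫_𝕜 = ⟪s, Dstar₁ x⟫_𝕜)
    (hRsym₁ : ∀ s t : S, ⟪R₁ s, t⟫_𝕜 = ⟪s, R₁ t⟫_𝕜) (hRR₁ : ∀ s : S, R₁ (R₁ s) = R₁ s)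
    (N : E → ℝ) (hN : ∀ w, 0 ≤ N w) {θΔ δP MP δQ MQ : ℝ} (hδP : 0 ≤ δP) (hMP : 0 ≤ MP) (hδQ : 0 ≤ δQ) (hMQ : 0 ≤ MQ)
    (hΔ : ∀ u v : E, ‖⟪u, Δ₁ v⟫_𝕜 - ⟪u, Δ₀ v⟫_𝕜‖ ≤ θΔ * N u * N v)
    (hP : ∀ w : E, ‖R₁ (Dstar₁ w) - R₀ (Dstar₀ w)‖ ≤ δP * N w) (hP₀ : ∀ w : E, ‖R₀ (Dstar₀ w)‖ ≤ MP * N w)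
    (hQ : ∀ w : E, ‖Q₁ w - Q₀ w‖ ≤ δQ * N w) (hQ₀ : ∀ w : E, ‖Q₀ w‖ ≤ MQ * N w) (u v : E) :
    ‖⟪u, laplaceAK Δ₁ D₁ R₁ Dstar₁ Q₁ (LinearMap.adjoint Q₁) a v⟫_𝕜 - ⟪u, laplaceAK Δ₀ D₀ R₀ Dstar₀ Q₀ (LinearMap.adjoint Q₀) a v⟫_𝕜‖ ≤
      (θΔ + δP * (2 * MP + δP) + ‖a‖ * (δQ * (2 * MQ + δQ))) * N u * N v := by
  rw [inner_laplaceAK_eq hadj₁ hDD₁ hRsym₁ hRR₁, inner_laplaceAK_eq hadj₀ hDD₀ hRsym₀ hRR₀]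
  have hPb := norm_inner_sub_inner_le (𝕜 := 𝕜) (fun w => R₁ (Dstar₁ w)) (fun w => R₀ (Dstar₀ w)) N hN hδP hMP hP hP₀ u v
  have hQb := norm_inner_sub_inner_le (𝕜 := 𝕜) (fun w => Q₁ w) (fun w => Q₀ w) N hN hδQ hMQ hQ hQ₀ u v
  have hsplit : ⟪u, Δ₁ v⟫_𝕜 + ⟪R₁ (Dstar₁ u), R₁ (Dstar₁ v)⟫_𝕜 + a * ⟪Q₁ u, Q₁ v⟫_𝕜 -
      (⟪u, Δ₀ v⟫_𝕜 + ⟪R₀ (Dstar₀ u), R₀ (Dstar₀ v)⟫_𝕜 + a * ⟪Q₀ u, Q₀ v⟫_𝕜) =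
      (⟪u, Δ₁ v⟫_𝕜 - ⟪u, Δ₀ v⟫_𝕜) + (⟪R₁ (Dstar₁ u), R₁ (Dstar₁ v)⟫_𝕜 - ⟪R₀ (Dstar₀ u), R₀ (Dstar₀ v)⟫_𝕜) +
        a * (⟪Q₁ u, Q₁ v⟫_𝕜 - ⟪Q₀ u, Q₀ v⟫_𝕜) := by ring
  rw [hsplit]
  have hNuv : 0 ≤ N u * N v := mul_nonneg (hN u) (hN v)
  calc ‖(⟪u, Δ₁ v⟫_𝕜 - ⟪u, Δ₀ v⟫_𝕜) + (⟪R₁ (Dstar₁ u), R₁ (Dstar₁ v)⟫_𝕜 - ⟪R₀ (Dstar₀ u), R₀ (Dstar₀ v)⟫_𝕜) +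
        a * (⟪Q₁ u, Q₁ v⟫_𝕜 - ⟪Q₀ u, Q₀ v⟫_𝕜)‖
      ≤ ‖⟪u, Δ₁ v⟫_𝕜 - ⟪u, Δ₀ v⟫_𝕜‖ + ‖⟪R₁ (Dstar₁ u), R₁ (Dstar₁ v)⟫_𝕜 - ⟪R₀ (Dstar₀ u), R₀ (Dstar₀ v)⟫_𝕜‖ +
          ‖a‖ * ‖⟪Q₁ u, Q₁ v⟫_𝕜 - ⟪Q₀ u, Q₀ v⟫_𝕜‖ := by
        refine (norm_add_le _ _).trans (add_le_add (norm_add_le _ _) ?_)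
        rw [norm_mul]
    _ ≤ θΔ * N u * N v + δP * (2 * MP + δP) * N u * N v + ‖a‖ * (δQ * (2 * MQ + δQ) * N u * N v) := by
        gcongr
        · exact hΔ u v
    _ = (θΔ + δP * (2 * MP + δP) + ‖a‖ * (δQ * (2 * MQ + δQ))) * N u * N v := by ring

end Structure

end Literature.MathematicalPhysics.QuantumFieldTheory.Balaban1983to89.B9Eq386GreenLipschitzEnergy

end
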